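import Summits.BirchSwinnertonDyer.BirchSwinnertonDyer.Theorems.QuadraticBranchSignedControlPlusEtaNonsurjPrimeLFunction
import Mathlib.RingTheory.PowerSeries.Order
import Mathlib.RingTheory.LocalRing.ResidueField.Basic
import HarnessLib

/-!
# Route `QuadraticBranchSignedControl` (rung K8, cell `bsd-potss`), residual crux
# `PlusEtaMainConjectureNonsurj` (stmt-BirchSwinnertonDyer-19606): the `λ`-SQUEEZE — on ANY row, Kobayashi's
# even main conjecture at `η` ⟸ `μ(X⁺(V/K_∞)^η) = 0` + `λ(X⁺(V/K_∞)^η) = λ(L_p⁺(V,η,X))` (both displayed) +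
# Thm. 2.2η + Thm. 4.1η rational clause; the general form of the prime-`L`-function road
# (seat `bsd-potss-k8eta-c2` g4; file 5, sequel of `…PlusEtaNonsurjPrimeLFunction.lean`)

WHAT. File 1 (`EtaPrimeRoad`, p508939): `μ = 0` + Thm. 4.1η (rational) ⟹ `g ∣ L_η` for a characteristic
generator `g` of `X⁺(V/K_∞)^η` (Gauss), and if `L_η` is PRIME the crux follows once `g ∉ Λˣ`. The general
squeeze behind it: with `g ∣ L_η` and `p ∤ L_η`, **`(g) = (L_η)` iff the reductions `ḡ, L̄_η ∈ 𝔽_p⟦T⟧` have the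
same order of vanishing** — i.e. iff `λ(X⁺(V/K_∞)^η) = λ(L_p⁺(V,η,X))` (`λ` = Weierstrass degree = `ord_T` of the
reduction mod `p`, for power series of unit content). This file proves that squeeze and the resulting road:

* §1 `Λ`-algebra: `map_residue_ne_zero_iff_hasUnitContent` (unit content = non-zero reduction mod `p`),
  **`span_eq_span_of_dvd_of_order_map_eq`** (`g ∣ L`, `p ∤ L`, `ord_T ḡ = ord_T L̄ ⟹ (g) = (L)`: the cofactor
  reduces to a unit of `𝔽_p⟦T⟧`, so its constant term is a `p`-adic unit, so it is a unit of `Λ`).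
* §2 **`quadraticBranchPlusEtaMainConjectureAt_of_hasUnitContent_of_order_map_eq`**: (C1⁺_η)(V,p) ⟸ `h22` +
  `h41` + `μ = 0` (displayed, the skeleton's `EtaMuZeroAt V p`) + `λ`-EQUALITY (displayed, on the node's frame:
  every generator `g` of `Char(D.X)` has `ord_T ḡ = ord_T L̄η`). NO `W`, no rank hypothesis, no Poitou–Tate, no
  Kitajima–Otsuki, no image hypothesis. File 1's prime road is the case where the `λ`-equality is automatic
  (`λ(L_η) = 1` and `T ∣ g`); seat g2's unit-row road is the case `λ = 0`.

WHY (numbers; seat g4's kit j273089, pre-registered P4/P4b, HOME/k8eta-c2/g4/lamtransfer_j273089.tsv): for the 30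
non-CM rows `V` of the census congruent mod `5` to a CM twist `V′` (Kraus–Oesterlé certificates j270119/j270714),
Hatley–Lei 2019 Thm. 4.6 (ii) + Prop. 5.1 give, GRANTED `μ = 0`, the `λ`-TRANSFER `λ(X⁺(V/K_∞)^η) + Σ_{Σ₀} δ_ℓ(V) =
λ(X⁺(V′/K_∞)^η) + Σ_{Σ₀} δ_ℓ(V′)` with explicit local terms `δ_ℓ` (multiplicity of `ℓ⁻¹` in the Euler factor of
`W = V ⊗ η` at `ℓ` mod `5`, times the number of primes of `ℚ_∞` over `ℓ`); the ANALYTIC twin of this identity, with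
`λ` := PARI's plus-`η` (resp. minus-`η`) `λ_an`, holds on **30/30** pairs for BOTH signs — e.g. 404325f1: `λ_an = 10 =
5 + 5·1` over 675a1 (`r_599 = 5`), 164700i1: `2 + 1 = 1 + 2` over 2700p1 (`ℓ = 61 ≡ 1`: double root). So on every
such row, `μ = 0` at the CM anchor ⟹ (Hatley–Lei) `μ = 0` and `λ(X^η(V)) = λ_an(V′) + Σδ(V′) − Σδ(V) = λ_an(V)`
(Burungale–Tian for the CM anchor's `λ`; the identity above) — exactly the two displayed binders of §2. Nothing
of this paragraph is asserted in the kernel; it motivates the shape of §2.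

HONEST FRAMING (cell `bsd-potss`, run/shared/lean/pub/bsd-potss/; FULL-BSD rank ≤ 1 programme,
tranche 1b, HUMAN RULING D-0036/D-0074): BOOKKEEPING / TOOL THEOREMS ONLY — no definition, no named
Literature fact minted, no Summits-side `def … : Prop`, no `sorry`, axioms standard. CONDITIONAL on the
DISPLAYED binders (`μ = 0`; `λ`-equality — an analytic-plus-transfer INPUT, not a kernel theorem) and on
Kobayashi 2003 Thm. 2.2 / Thm. 4.1 (rational clause) at `η` (named facts, hypothesis position). No stub of 19606
is proved by name; the crux stays OPEN; nothing is booked; no label / mark / count moves; `BSD(W,p)` is claimed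
for no pair. `--supports stmt-BirchSwinnertonDyer-19606`.

References: [Kobayashi2003] Thm. 2.2 (p. 5), §4 Even main conjecture + Thm. 4.1 first display (p. 8);
[GreenbergVatsal2000] p. 2 (2) and Thm. (1.4); [HatleyLei2019] Thm. 4.6, Prop. 5.1, Lemmas 5.3–5.4;
[Washington1997] §7.1, §13.1 (`λ`, `μ` of a power series); [EmertonPollackWeston2005] Def. 4.4.1 (shape only).
-/

set_option autoImplicit false
set_option linter.dupNamespace false

noncomputable section

open scoped Classical

open CongruenceSubgroup Field Function NumberField IsDedekindDomain WeierstrassCurve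
open Literature.NumberTheory.EllipticCurves
open Literature.NumberTheory.EllipticCurves.ModularForms
open Literature.NumberTheory.EllipticCurves.Rank1Residual
open Literature.NumberTheory.EllipticCurves.Rank1Residual.Typed
open Literature.NumberTheory.GaloisRepresentations
open Literature.NumberTheory.GaloisCohomology
open Literature.NumberTheory.EllipticCurves.IwasawaAlgebra
open Literature.NumberTheory.EllipticCurves.IwasawaDual ZpExtension
open Literature.NumberTheory.EllipticCurves.GreenbergVatsal2000
open Summit.BirchSwinnertonDyer.Rank1Residual.X11b.Levels
open Summit.BirchSwinnertonDyer.Rank1Residual.X11b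
open Summit.BirchSwinnertonDyer.Rank1Residual.Additive
open Summit.BirchSwinnertonDyer.Rank1Residual.Additive.SignedTwist
open scoped ContRepresentation
open Summit.BirchSwinnertonDyer.Rank1Residual.AdditivePotMult

namespace Summit.BirchSwinnertonDyer.BirchSwinnertonDyer.Theorems

namespace EtaPrimeRoad

/-! ## §1 `Λ`-algebra: the `λ`-squeeze -/

section Algebra

variable {p : ℕ} [hp : Fact p.Prime]

/-- **Unit content = non-zero reduction mod `p`.** A power series `g ∈ Λ = ℤ_p⟦T⟧` has a unit coefficient
(`μ(g) = 0`, Greenberg–Vatsal (2)) iff its coefficientwise reduction `ḡ ∈ 𝔽_p⟦T⟧` is non-zero (a `p`-adic integer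
is a unit iff its residue is non-zero). (The tree's `hasUnitContent_iff_map_residue_ne_zero` for a general local
ring lives in `Rubin1991/TwoVariableCMLines`; restated here for `ℤ_p` to keep the imports of this line light.)
[cite: GreenbergVatsal2000, p. 2 (2)] [cite: EmertonPollackWeston2005, Def. 4.4.1] -/
theorem map_residue_ne_zero_iff_hasUnitContent (g : IwasawaAlgebra p) :
    PowerSeries.map (IsLocalRing.residue ℤ_[p]) g ≠ 0 ↔ HasUnitContent g := by
  rw [hasUnitContent_def, ne_eq, PowerSeries.ext_iff, not_forall]
  refine exists_congr fun n ↦ ?_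
  rw [PowerSeries.coeff_map, map_zero, ← ne_eq, IsLocalRing.residue_ne_zero_iff_isUnit]

/-- **THE `λ`-SQUEEZE.** In `Λ = ℤ_p⟦T⟧`: if `g ∣ L`, `L` has unit content (`μ(L) = 0`) and the reductions
`ḡ, L̄ ∈ 𝔽_p⟦T⟧` have the same order of vanishing at `T = 0` (`λ(g) = λ(L)`), then `(g) = (L)`. Writing `L = g·h`:
`L̄ = ḡ·h̄ ≠ 0` in the DOMAIN `𝔽_p⟦T⟧`, `ord L̄ = ord ḡ + ord h̄`, so `ord h̄ = 0`, so `h(0)` is a `p`-adic unit, so `h`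
is a unit of `Λ`. The "one divisibility + equal `λ`- and `μ`-invariants ⟹ equality" step of every main-conjecture
squeeze. [cite: GreenbergVatsal2000, Thm. (1.4) and p. 2 (1)–(2)] [cite: Washington1997, §7.1 and §13.1] -/
theorem span_eq_span_of_dvd_of_order_map_eq {g L : IwasawaAlgebra p} (hdvd : g ∣ L) (hL : HasUnitContent L)
    (hord : (PowerSeries.map (IsLocalRing.residue ℤ_[p]) g).order =
      (PowerSeries.map (IsLocalRing.residue ℤ_[p]) L).order) :
    Ideal.span ({g} : Set (IwasawaAlgebra p)) = Ideal.span {L} := by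
  obtain ⟨h, rfl⟩ := hdvd
  have hL0 : PowerSeries.map (IsLocalRing.residue ℤ_[p]) (g * h) ≠ 0 :=
    (map_residue_ne_zero_iff_hasUnitContent _).mpr hL
  rw [map_mul] at hL0 hord
  have hg0 : PowerSeries.map (IsLocalRing.residue ℤ_[p]) g ≠ 0 := left_ne_zero_of_mul hL0
  rw [PowerSeries.order_mul] at hord
  -- `ord ḡ = ord ḡ + ord h̄` with `ord ḡ` finite forces `ord h̄ = 0`
  obtain ⟨n, hn⟩ := ENat.ne_top_iff_exists.mp (PowerSeries.order_finite_iff_ne_zero.mpr hg0).ne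
  have hh : (PowerSeries.map (IsLocalRing.residue ℤ_[p]) h).order = 0 := by
    rw [← hn] at hord
    induction hmo : (PowerSeries.map (IsLocalRing.residue ℤ_[p]) h).order using ENat.recTopCoe with
    | top => rw [hmo] at hord; exact absurd hord.symm (by simp)
    | coe m =>
      rw [hmo] at hord
      have : n = n + m := by exact_mod_cast hord
      have hm : m = 0 := by omega
      simp [hm]
  -- so `h(0)` is a unit, hence `h ∈ Λˣ`
  have hc : (PowerSeries.map (IsLocalRing.residue ℤ_[p]) h).constantCoeff ≠ 0 := fun h0 ↦
    (PowerSeries.order_ne_zero_iff_constCoeff_eq_zero.mpr h0) hh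
  rw [← PowerSeries.coeff_zero_eq_constantCoeff_apply, PowerSeries.coeff_map,
    PowerSeries.coeff_zero_eq_constantCoeff_apply] at hc
  have hu : IsUnit h :=
    PowerSeries.isUnit_iff_constantCoeff.mpr ((IsLocalRing.residue_ne_zero_iff_isUnit _).mp hc)
  exact Ideal.span_singleton_eq_span_singleton.mpr ⟨hu.unit, by rw [IsUnit.unit_spec]⟩

/-- `λ`-equality with a series of unit content transfers unit content: if `ord ḡ = ord L̄` and `p ∤ g` then
`p ∤ L` (the common order is finite). [cite: GreenbergVatsal2000, p. 2 (2)] -/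
theorem hasUnitContent_of_order_map_eq {g L : IwasawaAlgebra p} (hg : HasUnitContent g)
    (hord : (PowerSeries.map (IsLocalRing.residue ℤ_[p]) g).order =
      (PowerSeries.map (IsLocalRing.residue ℤ_[p]) L).order) : HasUnitContent L := by
  rw [← map_residue_ne_zero_iff_hasUnitContent] at hg ⊢
  intro hL
  rw [hL, PowerSeries.order_zero, PowerSeries.order_eq_top] at hord
  exact hg hord

end Algebra

/-! ## §2 `η`-side: (C1⁺_η)(V,p) ⟸ `μ = 0` + `λ`-equality -/

section Eta

variable (V : WeierstrassCurve ℚ) [V.IsElliptic] [V.IsGloballyMinimal] (p : ℕ) [hp : Fact p.Prime]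

/-- **THE `λ`-SQUEEZE ROAD at a pair (any rank, any image): (C1⁺_η)(V,p) ⟸ `μ(X⁺(V/K_∞)^η) = 0` +
`λ(X⁺(V/K_∞)^η) = λ(L_p⁺(V,η,X))`.** For `V` globally minimal, granted Kobayashi's Thm. 2.2 at `η` (`h22`) and the
RATIONAL clause of Thm. 4.1 at `η` (`h41`): IF every characteristic generator of every `η`-datum has unit content
(`hμ`, displayed — the skeleton's `EtaMuZeroAt V p`) AND, on the node's frame, every generator `g` of `Char(D.X)`
has `ord_T ḡ = ord_T L̄η` in `𝔽_p⟦T⟧` (`hlam`, displayed — the `λ`-EQUALITY; per row it is Hatley–Lei's transfer from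
a CM anchor + Burungale–Tian + PARI, see the module docstring), THEN `QuadraticBranchPlusEtaMainConjectureAt V p`:
`g ∣ pⁿ Lη` (Thm. 4.1η), `p ∤ g` ⟹ `g ∣ Lη` (Gauss), §1's squeeze. NO `W`, no rank / Selmer / Tamagawa input, no
Poitou–Tate, no Kitajima–Otsuki, no image hypothesis. CONDITIONAL on the displayed binders; nothing booked.
[cite: Kobayashi2003, §4 Even main conjecture and Thm. 4.1 first display (p. 8), Thm. 2.2 (p. 5)]
[cite: GreenbergVatsal2000, Thm. (1.4) and p. 2 (1)–(2)] [cite: HatleyLei2019, Thm. 4.6] -/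
theorem quadraticBranchPlusEtaMainConjectureAt_of_hasUnitContent_of_order_map_eq
    (h22 : Kobayashi2003.thm22_etaSignedSelmerDual_finite_torsion)
    (h41 : Kobayashi2003.thm41_plusEtaCharIdeal_dvd)
    (hμ : ∀ (K₀ : Type) [Field K₀] [NumberField K₀] [IsCyclotomicExtension {p} ℚ K₀]
        [(galRange (K := ℚ) K₀).Normal] (ηq : absoluteGaloisGroup ℚ →* ℤˣ),
        (∀ σ ∈ galRange (K := ℚ) K₀, ηq σ = 1) → ηq ≠ 1 →
      ∀ (κ : ZpExtension ℚ p) (γ : absoluteGaloisGroup ℚ),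
        κ.IsCyclotomic → κ.IsTopGenerator γ → γ ∈ galRange (K := ℚ) K₀ →
      ∀ (D : EtaSignedSelmerDualData V κ K₀ ℚ_[p] ηq γ 1) (g : IwasawaAlgebra p),
        D.charIdeal = Ideal.span {g} → HasUnitContent g)
    (hlam : ∀ (K₀ : Type) [Field K₀] [NumberField K₀] [IsCyclotomicExtension {p} ℚ K₀]
        [(galRange (K := ℚ) K₀).Normal] (ηq : absoluteGaloisGroup ℚ →* ℤˣ),
        (∀ σ ∈ galRange (K := ℚ) K₀, ηq σ = 1) → ηq ≠ 1 →
      ∀ {N : ℕ} [NeZero N] {f : CuspForm (Gamma0 N) 2},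
        p ≠ 2 → V.HasGoodReductionAtPrime p → V.frobeniusTrace p = 0 → IsNewformOf V f →
      ∀ (ϖ : ℚ), (if Even (p / 2) then (ϖ : ℝ) * V.realPeriodRat = plusPeriod f
          else (ϖ : ℝ) * V.imaginaryPeriodRat = minusPeriod f) →
      ∀ (Lη : IwasawaAlgebra p), IsQuadraticBranchPlusLFunction f p ϖ Lη →
      ∀ (κ : ZpExtension ℚ p) (γ : absoluteGaloisGroup ℚ),
        κ.IsCyclotomic → κ.IsTopGenerator γ → γ ∈ galRange (K := ℚ) K₀ → IsCyclotomicVariable p γ →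
      ∀ (D : EtaSignedSelmerDualData V κ K₀ ℚ_[p] ηq γ 1) (g : IwasawaAlgebra p),
        D.charIdeal = Ideal.span {g} →
          (PowerSeries.map (IsLocalRing.residue ℤ_[p]) g).order =
            (PowerSeries.map (IsLocalRing.residue ℤ_[p]) Lη).order) :
    QuadraticBranchPlusEtaMainConjectureAt V p := by
  intro K₀ _ _ _ _ ηq hηK hη1 N _ f hp2 hgood hap hf ϖ hϖ Lη hL κ γ hκ hγ hγK hγc D
  obtain ⟨hfin, htor⟩ :=
    EtaSignedSelmerDualData.finite_isTorsion_of_thm22 h22 hηK hp2 hgood hap hκ hγ hγK D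
  refine ⟨hfin, htor, ?_⟩
  obtain ⟨⟨n, hn⟩, -⟩ := EtaSignedSelmerDualData.thm41_plus_of_facts h22 h41 hηK hη1 hp2 hgood hap hf ϖ hϖ
    Lη hL hκ hγ hγK hγc D
  haveI : D.charIdeal.IsPrincipal := charIdeal_isPrincipal_holds p D.X
  obtain ⟨g, hg⟩ := Submodule.IsPrincipal.principal D.charIdeal
  have hg' : D.charIdeal = Ideal.span {g} := hg
  have hu : HasUnitContent g := hμ K₀ ηq hηK hη1 κ γ hκ hγ hγK D g hg'
  have hord := hlam K₀ ηq hηK hη1 hp2 hgood hap hf ϖ hϖ Lη hL κ γ hκ hγ hγK hγc D g hg'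
  rw [hg', Ideal.mem_span_singleton] at hn
  have hC : ((p : IwasawaAlgebra p) ^ n : IwasawaAlgebra p) = PowerSeries.C ((p : ℤ_[p]) ^ n) := by
    rw [map_pow, map_natCast]
  rw [hC] at hn
  rw [hg']
  exact span_eq_span_of_dvd_of_order_map_eq (dvd_of_dvd_C_pow_mul_of_hasUnitContent hu n hn)
    (hasUnitContent_of_order_map_eq hu hord) hord

end Eta

end EtaPrimeRoad

end Summit.BirchSwinnertonDyer.BirchSwinnertonDyer.Theorems

end
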